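import Summits.AtomisticToContinuum.FouriersLaw.Theses.PuiseuxTransferLedger
import Literature.MathematicalPhysics.KineticTheory.LangevinChainKernel
import Literature.MathematicalPhysics.KineticTheory.LangevinChainGibbs
import Literature.MathematicalPhysics.KineticTheory.HardTetherChain

/-!
# TwoModeBulk (stmt-AtomisticToContinuum-12111) — crux-ideate round 1, ideator 2: first lemmas of the line
`cut-bond-harmonic-measure`

Elaboration sketch only (statements; no proofs claimed).  `P = pinnedChain ω₂ lam β γ`,
`K_t = P.transitionKernel N T T t` (the constructed equal-temperature Langevin kernels),
`μ_T = P.gibbsMeasure N T`, `j_k = P.bondCurrent N k`, `E_{≤k} = HardTether.leftEnergy P N k`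
(BLR's left block energy with the symmetric split of the cut bond).

Already PROVED in tree and used by the line: the pointwise block-energy balance
`j_k + L_{T_L,T_R}(E_{≤k}) = γ (T_L - p_0²)` for `k + 1 < N`
(`Literature.MathematicalPhysics.KineticTheory.HeatConduction.HardTether.bondCurrent_add_generator_leftEnergy`).

* `CutBondProfileIdentity` — FIRST LEMMA of the line: under weak-NESS uniqueness the kinetic-temperature
  response profile of the crux is, for EVERY cut bond `k` with `k + 1 < N`,
  `θ_N(i) = ½·sgn(k + ½ - i) - T⁻² ∫₀^∞ Cov_{μ_T}(p_i²(0), j_k(t)) dt`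
  (harmonic-measure / power-splitting reading: `θ_N(i) + ½` = fraction of an energy excess deposited at
  site `i` in equilibrium that eventually leaves through the LEFT bath).
* `CornerKernelIdentity` — the profile is the difference of the two CORNER columns of the Bochner-positive
  `ω = 0` kinetic-energy kernel `K_N(i,j) = ∫_{-∞}^{∞} Cov_{μ_T}(p_i²(0), p_j²(t)) dt`:
  `θ_N(i) = (γ/4T²)(K_N(0,i) - K_N(N-1,i))`, with the sum rule `K_N(0,i) + K_N(N-1,i) = 2T²/γ`.
* `ToeplitzTwoSidedLayers` — the CLOSING LEMMA (pure real analysis, provable now): a real sequence solving a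
  symmetric finite-range Toeplitz recurrence in the bulk of `{0,…,N-1}` whose (palindromic) symbol has a double
  root at `1` and no other unimodular root has increments `u(i+1) - u(i) = s + O(θ^i + θ^(N-2-i))`, with
  `θ < 1` and the constant depending only on the symbol (NOT on `N`), linearly on the near-boundary increments.
-/

namespace Summit.AtomisticToContinuum.FouriersLaw.Cruxes.TwoModeBulk.Ideator2

open MeasureTheory Filter
open scoped NNReal BigOperators Polynomial
open Literature.MathematicalPhysics.KineticTheory.HeatConduction

/-- FIRST LEMMA (card `cut-bond-harmonic-measure`): the cut-bond representation of the linear-response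
kinetic-temperature profile.  Hypotheses exactly as in the crux (all parameters `> 0`, weak-NESS uniqueness, a
steady-state family `μ`); conclusion: whenever the profile difference quotient at site `i` has a limit `tᵢ`,
`tᵢ = ½·sgn(k + ½ - i) - T⁻² ∫₀^∞ ∫ (p_i² - T)·(K_t j_k) dμ_T dt` for every bond `k` with `k + 1 < N`
(the integrand is `Cov_{μ_T}(p_i²(0), j_k(t))` since `μ_T(j_k) = 0`).  Content: response density
`h = (γ/2T²) Θ ∫₀^∞ K_t(p_0² - p_{N-1}²) dt` (fixed-`N` Kubo formula at the explicit Gibbs point), the in-tree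
block balance `bondCurrent_add_generator_leftEnergy` at bond `k` for the left AND the right block, and
`∫₀^∞ K_t L₀ f dt = μ_T(f) - f` (fixed-`N` Harris mixing at equal temperatures). -/
def CutBondProfileIdentity : Prop :=
  ∀ ω₂ lam β γ : ℝ, 0 < ω₂ → 0 < lam → 0 < β → 0 < γ →
    (∀ (N : ℕ) (T_L T_R : ℝ), 0 < T_L → 0 < T_R → ∀ μ ν : Measure (PhaseSpace N),
      (pinnedChain ω₂ lam β γ).IsSteadyState N T_L T_R μ →
      (pinnedChain ω₂ lam β γ).IsSteadyState N T_L T_R ν → μ = ν) →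
    ∀ μ : (N : ℕ) → ℝ → ℝ → Measure (PhaseSpace N),
      (∀ (N : ℕ) (T_L T_R : ℝ), 0 < T_L → 0 < T_R →
        (pinnedChain ω₂ lam β γ).IsSteadyState N T_L T_R (μ N T_L T_R)) →
    ∀ T : ℝ, 0 < T → ∀ (N : ℕ) (i k : Fin N), k.val + 1 < N → ∀ tᵢ : ℝ,
      Tendsto (fun δ : ℝ => ((∫ x, (x.2 i) ^ 2 ∂(μ N (T + δ / 2) (T - δ / 2))) -
          ∫ x, (x.2 i) ^ 2 ∂(μ N T T)) / δ) (nhdsWithin 0 {(0 : ℝ)}ᶜ) (nhds tᵢ) →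
      tᵢ = (if i.val ≤ k.val then (1 : ℝ) / 2 else -(1 / 2)) -
          T⁻¹ ^ 2 * ∫ t in Set.Ioi (0 : ℝ), ∫ x, ((x.2 i) ^ 2 - T) *
              (∫ y, (pinnedChain ω₂ lam β γ).bondCurrent N k y
                  ∂((pinnedChain ω₂ lam β γ).transitionKernel N T T t.toNNReal x))
            ∂((pinnedChain ω₂ lam β γ).gibbsMeasure N T)

/-- The `ω = 0` (two-sided time-integrated) kinetic-energy covariance kernel of the open equilibrium chain,
`K_N(i,j) = ∫₀^∞ [Cov_{μ_T}(p_i²(0), p_j²(t)) + Cov_{μ_T}(p_j²(0), p_i²(t))] dt` (symmetric; positive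
semidefinite by Bochner's theorem for the stationary equilibrium process). -/
noncomputable def omegaZeroKernel (ω₂ lam β γ T : ℝ) (N : ℕ) (i j : Fin N) : ℝ :=
  ∫ t in Set.Ioi (0 : ℝ),
    ((∫ x, ((x.2 i) ^ 2 - T) * (∫ y, (y.2 j) ^ 2 ∂((pinnedChain ω₂ lam β γ).transitionKernel N T T t.toNNReal x))
        ∂((pinnedChain ω₂ lam β γ).gibbsMeasure N T)) +
      ∫ x, ((x.2 j) ^ 2 - T) * (∫ y, (y.2 i) ^ 2 ∂((pinnedChain ω₂ lam β γ).transitionKernel N T T t.toNNReal x))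
        ∂((pinnedChain ω₂ lam β γ).gibbsMeasure N T))

/-- CORNER–KERNEL IDENTITY + SUM RULE: under the hypotheses of the crux, every profile limit `tᵢ` equals
`(γ/4T²)(K_N(0,i) - K_N(N-1,i))`, and `K_N(0,i) + K_N(N-1,i) = 2T²/γ` (from `L₀ H = γ(2T - p_0² - p_{N-1}²)`
and Θ-reversibility).  Consequence recorded in the card: the conductance is the corner entry,
`g_N = γ - (γ²/2T²) K_N(0,0)`. -/
def CornerKernelIdentity : Prop :=
  ∀ ω₂ lam β γ : ℝ, 0 < ω₂ → 0 < lam → 0 < β → 0 < γ →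
    (∀ (N : ℕ) (T_L T_R : ℝ), 0 < T_L → 0 < T_R → ∀ μ ν : Measure (PhaseSpace N),
      (pinnedChain ω₂ lam β γ).IsSteadyState N T_L T_R μ →
      (pinnedChain ω₂ lam β γ).IsSteadyState N T_L T_R ν → μ = ν) →
    ∀ μ : (N : ℕ) → ℝ → ℝ → Measure (PhaseSpace N),
      (∀ (N : ℕ) (T_L T_R : ℝ), 0 < T_L → 0 < T_R →
        (pinnedChain ω₂ lam β γ).IsSteadyState N T_L T_R (μ N T_L T_R)) →
    ∀ T : ℝ, 0 < T → ∀ (N : ℕ) (i b₀ b₁ : Fin N), 2 ≤ N → b₀.val = 0 → b₁.val = N - 1 →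
      (omegaZeroKernel ω₂ lam β γ T N b₀ i + omegaZeroKernel ω₂ lam β γ T N b₁ i = 2 * T ^ 2 / γ) ∧
      ∀ tᵢ : ℝ,
        Tendsto (fun δ : ℝ => ((∫ x, (x.2 i) ^ 2 ∂(μ N (T + δ / 2) (T - δ / 2))) -
            ∫ x, (x.2 i) ^ 2 ∂(μ N T T)) / δ) (nhdsWithin 0 {(0 : ℝ)}ᶜ) (nhds tᵢ) →
        tᵢ = γ / (4 * T ^ 2) * (omegaZeroKernel ω₂ lam β γ T N b₀ i - omegaZeroKernel ω₂ lam β γ T N b₁ i)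

/-- The palindromic symbol polynomial `p(z) = ∑_{j=0}^{2m} a(|j-m|) z^j` of a symmetric Toeplitz recurrence
with coefficient sequence `a : ℕ → ℝ` of range `m`. -/
noncomputable def symbolPoly (m : ℕ) (a : ℕ → ℝ) : ℂ[X] :=
  ∑ j ∈ Finset.range (2 * m + 1), Polynomial.C ((a (Int.natAbs ((j : ℤ) - m))) : ℂ) * Polynomial.X ^ j

/-- CLOSING LEMMA (discrete Saint-Venant / Wiener–Hopf for finite-range symmetric Toeplitz recurrences):
if the symbol has root `1` with multiplicity exactly two and no other root on the unit circle, then every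
real solution of the recurrence in the bulk window of `{0, …, N-1}` has increments equal to a constant `s`
up to two-sided geometric layers, with rate `θ < 1` and constant `C` depending ONLY on `(m, a)` (not on `N`),
and linearly on the size of the increments in the two boundary windows of width `2m`. -/
def ToeplitzTwoSidedLayers : Prop :=
  ∀ (m : ℕ) (a : ℕ → ℝ), 0 < m → a m ≠ 0 →
    (symbolPoly m a).rootMultiplicity 1 = 2 →
    (∀ z : ℂ, ‖z‖ = 1 → (symbolPoly m a).IsRoot z → z = 1) →
    ∃ θ C : ℝ, 0 ≤ θ ∧ θ < 1 ∧ 0 ≤ C ∧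
      ∀ (N : ℕ) (u : ℕ → ℝ),
        (∀ i : ℕ, m ≤ i → i + m + 1 ≤ N →
          ∑ j ∈ Finset.range (2 * m + 1), a (Int.natAbs ((j : ℤ) - m)) * u (i + j - m) = 0) →
        ∃ s : ℝ, ∀ i : ℕ, i + 2 ≤ N →
          |u (i + 1) - u i - s| ≤
            C * (∑ j ∈ Finset.range N, if (j < 2 * m ∨ N ≤ j + 2 * m + 1) then |u (j + 1) - u j| else 0) *
              (θ ^ i + θ ^ (N - 2 - i))

/-- Consistency probe (elaboration only): the crux decl of the route is in scope by name. -/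
example : Prop := Summit.AtomisticToContinuum.FouriersLaw.Theses.PuiseuxTransferLedger.TwoModeBulk

end Summit.AtomisticToContinuum.FouriersLaw.Cruxes.TwoModeBulk.Ideator2
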